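import Literature.IUT.LogThetaLattice.GlobalKummerNonInterference
import Literature.IUT.LogThetaLattice.PacketLogVolumes
import Literature.IUT.LogThetaLattice.StripFrameWitness
import Literature.IUT.LogThetaLattice.BiCoresRealified
import Literature.IUT.LogThetaLattice.HolomorphicLogShells
import Literature.NumberTheory.GaloisRepresentations.PadicResidueIndex
import HarnessLib

/-!
# [IUTchIII] §1–§3 interface predicates bound INSIDE the L6 cone certificate: four universal-closure certificates
# (`LocalMonoidsDetectIntegrality`, `Prop39ii_monoAnalyticCompat`, `BiCoricData.RealifiedRigidAt`, `LogLinkVolumeCompatible`)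

S. Mochizuki, *Inter-universal Teichmüller theory III*, kurims manuscript (May 2020), Prop. 3.10 (ii) p. 148, Prop. 3.9 (ii)
p. 116, Thm. 1.5 (v) pp. 50–51 (with [IUTchII] Cor. 4.10 (v) p. 160), Prop. 1.2 (iii) p. 31 [claim: Mochizuki2012, status: disputed]
(IUTchIII §1–§3, kurims pp.31-148).  abc-iut cell, D-0079 L-K «cone below S, unconditional», K-L6 slice (abc-iut-w4-d007 gen 10, row
«KL6-CLOSURE-CERTS»).  PROOF-ONLY (no `def`, no `instance`; nothing of the statement files of abc-iut-L6-t3, L6-t4, L6-t6 is re-typed).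

The frozen FACT-LIST rows **F-2089** `LocalMonoidsDetectIntegrality`, **F-2114** `Prop39ii_monoAnalyticCompat`, **F-2066**
`BiCoricData.RealifiedRigidAt`, **F-0429** `LogLinkVolumeCompatible` occur in HYPOTHESIS position inside the typed statements of
the cone rows IUTchIII:Prop3.10(ii) · Prop3.9(ii) · Thm1.5(v), Thm2.2(ii) · Prop1.2(ii)(iii), Prop3.9(iv) (abc-iut-w5-d012
`L6-SLICE-INPUT-CENSUS-v2`, ca24e4516e42b12c) with labels `model-witness` / `conditional`: an instance-form theorem existed, a
decision of the universal closure did not.  All four are predicates on ABSTRACT data (an arbitrary family of subsets `Ψ_v ⊆ K`; an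
arbitrary set of bijections and two arbitrary set-functions; an arbitrary `BiCoricData` over an arbitrary `StripFrame`; an
arbitrary `PadicLogOnUnits` record, whose `log` is «junk» off the principal units by design).  Their universal closures are
FALSE, as shown below at explicit degenerate data; so the rows are consumable only in instance form at the genuine carrier, where
the tree already holds the theorems (FACT-LIST class «universal-closure REFUTED / schema; instance forms …»):

* F-2089 — `localMonoidsDetectIntegrality_places` (abc-iut-w4-d009, `GlobalKummerNonInterferenceProofs`: the places model
  `𝕍 = {finite places} ⊔ {K →+* ℂ}`).  Refuted here for an EMPTY index of places (`not_localMonoidsDetectIntegrality_of_isEmpty`).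
* F-2114 — `prop39ii_monoAnalyticCompat_localField`, `…_of_image_eq`, `…_of_preserves`, `…_integralStructure`, `…_logVolume`
  (abc-iut-L6-t6 / w4-d009 / S-lineage).  Refuted here for the constant «volumes» `0` and `1` on a point
  (`not_prop39ii_monoAnalyticCompat_const`).
* F-2066 — `BiCoricData.realifiedRigidAt_of_realifiedD` (abc-iut-w4-d009: HOLDS whenever `D^⊩(−)` is [IUTchII] Cor. 4.5 (ii)'s
  functor), `KitsToy.realifiedRigidAt`, `rlfBiCoric_realifiedRigidAt`.  Refuted here at abc-iut-L6-t3's witness datum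
  `Witness.twoBiCoric` (`D^⊩(−) := 𝟭` over the frame whose `D^⊢`-prime-strips form the one-object groupoid on `{±1}`): the
  automorphism `−1` (`Witness.negIso_ne_refl`) — `not_realifiedRigidAt_twoBiCoric`.  (The same datum already carried
  `Witness.two_biCoricRealifiedPolyIso_not_subsingleton`; this file states the consequence for the FACT-LIST predicate by name.)
* F-0429 — `logLinkVolumeCompatible_ofUnitLog` (abc-iut-w4-d102: HOLDS for the analytic `p`-adic logarithm `unitLog` and an
  ISOMETRIC `e`).  Refuted here through its first conjunct `LogVolumeCompatible L.log`: the record `PadicLogOnUnits K` constrains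
  `log` only on the principal units `1 + p*𝒪_k`; off them `log` is free, and `exists_padicLogOnUnits_not_logVolumeCompatible`
  builds, in ANY nonarchimedean local field with a topologically nilpotent unit `ϖ` and a unit `c` with `‖c − 1‖ > ‖ϖ‖`, a
  lawful record whose `log` is `x ↦ ϖ·(x − c)` on the ball `c + ϖ𝒪_k ⊆ 𝒪_k^×` — it maps that ball (volume `[𝒪:ϖ𝒪]⁻¹`)
  injectively onto `ϖ²𝒪_k` (volume `[𝒪:ϖ𝒪]⁻²`), and `[𝒪:ϖ𝒪] ≥ 2` (`two_le_resIndex`).  Closed at `ℚ₃`, `ϖ = 3`, `c = −1`.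

HONEST FRAMING: a refuted universal closure is a statement about OUR typing (the records admit degenerate inhabitants), not about
the printed propositions, which concern the genuine places, the genuine Haar log-volumes, [IUTchII] Cor. 4.5 (ii)'s functor and THE
`p`-adic logarithm — where the cited instance-form theorems apply.  Nothing here bears on [IUTchIII] Cor. 3.12 or takes a side;
typed ≠ proved; nothing asserts abc proved or refuted.
-/

noncomputable section

namespace Literature.IUT.LogThetaLattice

open CategoryTheory Set Metric
open scoped Pointwise NNReal
open Literature.AnabelianGeometry.AbsoluteAnabelian
open Literature.NumberTheory.GaloisRepresentations.Ultrametric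

universe u v

/-! ## F-2089 `LocalMonoidsDetectIntegrality` ([IUTchIII] Prop 3.10 (ii)) -/

/-- **IUTchIII:Prop3.10(ii)** (kurims p.148) With NO places (`V` empty) the interface axiom `LocalMonoidsDetectIntegrality Ψ`
fails: its left side «`x ∈ Ψ_v` for all `v`» is vacuous at `x = 0`, its right side demands `x ≠ 0`.
[claim: Mochizuki2012, status: disputed] (IUTchIII §3 Prop 3.10 (ii), kurims p.148) -/
theorem not_localMonoidsDetectIntegrality_of_isEmpty {K : Type u} [Field K] [NumberField K] {V : Type v} [IsEmpty V]
    (Ψ : V → Set K) : ¬ LocalMonoidsDetectIntegrality Ψ :=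
  fun h => ((h 0).mp fun v => isEmptyElim v).1 rfl

/-- **F-2089 is a schema**: the universal closure of `LocalMonoidsDetectIntegrality` is FALSE (witness `K = ℚ`, `V = ∅`); the
instance form the cone uses is `localMonoidsDetectIntegrality_places`. [claim: Mochizuki2012, status: disputed] (IUTchIII §3 Prop 3.10 (ii), kurims p.148) -/
theorem not_forall_localMonoidsDetectIntegrality :
    ¬ ∀ (K : Type) [Field K] [NumberField K] (V : Type) (Ψ : V → Set K), LocalMonoidsDetectIntegrality Ψ :=
  fun h => not_localMonoidsDetectIntegrality_of_isEmpty (K := ℚ) (V := PEmpty) (fun v => nomatch v)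
    (h ℚ PEmpty fun v => nomatch v)

/-! ## F-2114 `Prop39ii_monoAnalyticCompat` ([IUTchIII] Prop 3.9 (ii)) -/

/-- **IUTchIII:Prop3.9(ii)** (kurims p.116) The predicate `Prop39ii_monoAnalyticCompat poly μD μF` on ABSTRACT «log-volumes» fails
for the constant functions `μD = 0`, `μF = 1` on a point and the identity poly-isomorphism.
[claim: Mochizuki2012, status: disputed] (IUTchIII §3 Prop 3.9 (ii), kurims p.116) -/
theorem not_prop39ii_monoAnalyticCompat_const :
    ¬ Prop39ii_monoAnalyticCompat ({Equiv.refl PUnit.{1}} : Set (PUnit ≃ PUnit)) (fun _ => (0 : ℝ)) (fun _ => 1) :=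
  fun h => zero_ne_one (h (Equiv.refl _) (Set.mem_singleton _) ∅)

/-- **F-2114 is a schema**: the universal closure of `Prop39ii_monoAnalyticCompat` is FALSE; the instance forms the cone uses are
`prop39ii_monoAnalyticCompat_localField` / `…_of_image_eq` / `…_of_preserves` (Haar log-volumes, isometric poly-isomorphisms).
[claim: Mochizuki2012, status: disputed] (IUTchIII §3 Prop 3.9 (ii), kurims p.116) -/
theorem not_forall_prop39ii_monoAnalyticCompat :
    ¬ ∀ (XD XF : Type) (poly : Set (XD ≃ XF)) (μD : Set XD → ℝ) (μF : Set XF → ℝ),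
      Prop39ii_monoAnalyticCompat poly μD μF :=
  fun h => not_prop39ii_monoAnalyticCompat_const (h PUnit PUnit _ _ _)

/-! ## F-2066 `BiCoricData.RealifiedRigidAt` ([IUTchIII] Thm 1.5 (v) / [IUTchII] Cor 4.10 (v)) -/

/-- **IUTchIII:Thm1.5(v)** (kurims p.50) At abc-iut-L6-t3's witness bi-coric datum `Witness.twoBiCoric` (`D^⊩(−) := 𝟭` over the frame
whose `D^⊢`-prime-strip category is the one-object groupoid on `ℤˣ = {±1}`) the rigidity predicate FAILS at the pair `(pt, pt)`:
the parallel isomorphisms `1` and `−1` are sent to different isomorphisms of `D^⊩`-data.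
[claim: Mochizuki2012, status: disputed] (IUTchIII §1 Thm 1.5 (v), kurims p.50) -/
theorem not_realifiedRigidAt_twoBiCoric : ¬ Witness.twoBiCoric.RealifiedRigidAt Witness.pt Witness.pt := by
  intro h
  have key := congrArg Iso.hom (h Witness.negIso (Iso.refl Witness.pt))
  exact Witness.negIso_ne_refl (Iso.ext key)

/-- **F-2066 is a schema**: the universal closure of `BiCoricData.RealifiedRigidAt` (over all frames, bi-coric data and pairs of
`D^⊢`-prime-strips) is FALSE; the instance form the cone uses is `BiCoricData.realifiedRigidAt_of_realifiedD` (rigidity HOLDS whenever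
`D^⊩(−)` is [IUTchII] Cor 4.5 (ii)'s functor). [claim: Mochizuki2012, status: disputed] (IUTchIII §1 Thm 1.5 (v), kurims p.50) -/
theorem not_forall_realifiedRigidAt :
    ¬ ∀ (S : StripFrame.{0}) (B : BiCoricData S) (X Y : S.Dv), B.RealifiedRigidAt X Y :=
  fun h => not_realifiedRigidAt_twoBiCoric (h Witness.twoFrame Witness.twoBiCoric Witness.pt Witness.pt)

/-! ## F-0429 `LogLinkVolumeCompatible` ([IUTchIII] Prop 1.2 (iii)) — through its conjunct `LogVolumeCompatible L.log` -/

section PadicLog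

variable {K : Type*} [NontriviallyNormedField K] [IsUltrametricDist K] [ProperSpace K] [MeasurableSpace K] [BorelSpace K]

/-- **IUTchIII:Prop1.2(iii)** (kurims p.31; [AbsTopIII] Prop 5.7 (i)(c)) In any nonarchimedean local field `K`, given a unit-modulus
element `c` and a non-zero `ϖ` with `‖ϖ‖ < 1` and `‖ϖ‖ < ‖c − 1‖`, there is a LAWFUL `PadicLogOnUnits K` record with `p* := ϖ` —
`log x := x − 1` on the principal units `1 + ϖ𝒪_K` (so `log(1 + p*𝒪) = p*𝒪` injectively, as the record demands) and the junk value
`log x := ϖ·(x − c)` elsewhere — whose `log` is NOT log-volume compatible: it maps the compact open ball `c + ϖ𝒪_K ⊆ 𝒪_K^×` (volume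
`[𝒪:ϖ𝒪]⁻¹`) injectively onto `ϖ²𝒪_K` (volume `[𝒪:ϖ𝒪]⁻²`), and `[𝒪:ϖ𝒪] ≥ 2`.  So `LogVolumeCompatible` is a genuine hypothesis on
THE logarithm, not a consequence of the record's axioms. [claim: Mochizuki2012, status: disputed] (IUTchIII §1 Prop 1.2 (iii), kurims p.31) -/
theorem exists_padicLogOnUnits_not_logVolumeCompatible (ϖ : Kˣ) (hϖ : ‖(ϖ : K)‖ < 1) (c : K) (hc : ‖c‖ = 1)
    (hc1 : ‖(ϖ : K)‖ < ‖c - 1‖) :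
    ∃ L : PadicLogOnUnits K, L.pstar = (ϖ : K) ∧ ¬ LogVolumeCompatible L.log := by
  classical
  let L : PadicLogOnUnits K :=
    { log := fun x => if ‖x - 1‖ ≤ ‖(ϖ : K)‖ then x - 1 else (ϖ : K) * (x - c)
      pstar := (ϖ : K)
      pstar_ne_zero := ϖ.ne_zero
      norm_pstar_lt_one := hϖ
      image_principalUnits := by
        ext y
        simp only [mem_image, mem_closedBall, dist_eq_norm, sub_zero]
        constructor
        · rintro ⟨x, hx, rfl⟩
          rw [if_pos hx]
          exact hx
        · intro hy
          refine ⟨y + 1, by rwa [add_sub_cancel_right], ?_⟩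
          rw [if_pos (by rwa [add_sub_cancel_right]), add_sub_cancel_right]
      injOn_principalUnits := by
        intro x hx x' hx' hxx'
        rw [mem_closedBall, dist_eq_norm] at hx hx'
        have h1 : x - 1 = x' - 1 := by
          have := hxx'
          simp only at this
          rwa [if_pos hx, if_pos hx'] at this
        exact sub_left_injective h1 }
  refine ⟨L, rfl, fun hcompat => ?_⟩
  -- the bad compact open set `A := c + ϖ𝒪_K`
  have hB : closedBall (0 : K) 1 ∈ compactOpens K :=
    ⟨⟨0, mem_closedBall_self zero_le_one⟩, isCompact_closedBall 0 1, IsUltrametricDist.isOpen_closedBall 0 one_ne_zero⟩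
  set A : Set K := c +ᵥ ((ϖ : Kˣ) • closedBall (0 : K) 1) with hA_def
  have hA : A ∈ compactOpens K := vadd_mem_compactOpens c (units_smul_mem_compactOpens ϖ hB)
  -- elements of `A` are `c + ϖ b` with `‖b‖ ≤ 1`
  have hmemA : ∀ x ∈ A, ∃ b : K, ‖b‖ ≤ 1 ∧ x = c + (ϖ : K) * b := by
    intro x hx
    obtain ⟨y, hy, rfl⟩ := Set.mem_vadd_set.mp hx
    obtain ⟨b, hb, rfl⟩ := Set.mem_smul_set.mp hy
    rw [mem_closedBall, dist_zero_right] at hb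
    exact ⟨b, hb, by rw [vadd_eq_add, Units.smul_def, smul_eq_mul]⟩
  have hsmall : ∀ b : K, ‖b‖ ≤ 1 → ‖(ϖ : K) * b‖ ≤ ‖(ϖ : K)‖ := fun b hb => by
    rw [norm_mul]
    exact mul_le_of_le_one_right (norm_nonneg _) hb
  -- `A ⊆ 𝒪_K^×`
  have hAu : A ⊆ {x : K | ‖x‖ = 1} := by
    intro x hx
    obtain ⟨b, hb, rfl⟩ := hmemA x hx
    have hne : ‖c‖ ≠ ‖(ϖ : K) * b‖ := by
      rw [hc]; exact (((hsmall b hb).trans_lt hϖ).ne).symm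
    show ‖c + (ϖ : K) * b‖ = 1
    rw [IsUltrametricDist.norm_add_eq_max_of_norm_ne_norm hne, hc, max_eq_left]
    exact ((hsmall b hb).trans hϖ.le)
  -- on `A` the logarithm is the junk branch `x ↦ ϖ (x - c)`
  have hlogA : ∀ x ∈ A, L.log x = (ϖ : K) * (x - c) := by
    intro x hx
    obtain ⟨b, hb, rfl⟩ := hmemA x hx
    have hne : ‖c - 1‖ ≠ ‖(ϖ : K) * b‖ := (((hsmall b hb).trans_lt hc1).ne).symm
    have hgt : ¬ ‖c + (ϖ : K) * b - 1‖ ≤ ‖(ϖ : K)‖ := by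
      rw [show c + (ϖ : K) * b - 1 = (c - 1) + (ϖ : K) * b by ring,
        IsUltrametricDist.norm_add_eq_max_of_norm_ne_norm hne, not_le]
      exact lt_max_of_lt_left hc1
    show (if ‖c + (ϖ : K) * b - 1‖ ≤ ‖(ϖ : K)‖ then c + (ϖ : K) * b - 1 else (ϖ : K) * (c + (ϖ : K) * b - c)) =
      (ϖ : K) * (c + (ϖ : K) * b - c)
    rw [if_neg hgt]
  have hinj : InjOn L.log A := by
    intro x hx x' hx' hxx'
    rw [hlogA x hx, hlogA x' hx'] at hxx'
    exact sub_left_injective (mul_left_cancel₀ ϖ.ne_zero hxx')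
  -- its image is `ϖ² 𝒪_K`
  have himg : L.log '' A = ((ϖ ^ 2 : Kˣ)) • closedBall (0 : K) 1 := by
    ext y
    constructor
    · rintro ⟨x, hx, rfl⟩
      obtain ⟨b, hb, hxb⟩ := hmemA x hx
      rw [hlogA x hx, hxb]
      refine Set.mem_smul_set.mpr ⟨b, by rwa [mem_closedBall, dist_zero_right], ?_⟩
      rw [Units.smul_def, smul_eq_mul, Units.val_pow_eq_pow_val]
      ring
    · intro hy
      obtain ⟨b, hb, rfl⟩ := Set.mem_smul_set.mp hy
      have hxA : c + (ϖ : K) * b ∈ A := by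
        refine Set.mem_vadd_set.mpr ⟨(ϖ : Kˣ) • b, Set.smul_mem_smul_set hb, ?_⟩
        rw [vadd_eq_add, Units.smul_def, smul_eq_mul]
      refine ⟨c + (ϖ : K) * b, hxA, ?_⟩
      rw [hlogA _ hxA, Units.smul_def, smul_eq_mul, Units.val_pow_eq_pow_val]
      ring
  have himgM : L.log '' A ∈ compactOpens K := by
    rw [himg]; exact units_smul_mem_compactOpens _ hB
  -- volumes: `[𝒪 : ϖ𝒪]⁻¹` versus `[𝒪 : ϖ𝒪]⁻²`
  have hvolA : localVolume K A = ((resIndex ϖ : ℝ) ^ 1)⁻¹ := by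
    rw [hA_def, localVolume_vadd, ← localVolume_piBall_pow hϖ.le 1, pow_one]
  have hvolI : localVolume K (L.log '' A) = ((resIndex ϖ : ℝ) ^ 2)⁻¹ := by
    rw [himg, localVolume_piBall_pow hϖ.le 2]
  have heq : localVolume K A = localVolume K (L.log '' A) :=
    Real.log_injOn_pos (Set.mem_Ioi.mpr (localVolume_pos hA)) (Set.mem_Ioi.mpr (localVolume_pos himgM))
      (hcompat A hA hAu hinj himgM)
  rw [hvolA, hvolI, inv_inj, pow_one] at heq
  have hr : (2 : ℝ) ≤ resIndex ϖ := by exact_mod_cast two_le_resIndex hϖ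
  nlinarith [heq, hr]

/-- **F-0429 is a schema**: the universal closure of `LogLinkVolumeCompatible` (over all nonarchimedean local fields `K`, `K'`, all
`PadicLogOnUnits K` and all `e : K ≃+* K'`) is FALSE — witness `K = K' = ℚ₃`, `e = id`, the lawful junk logarithm of
`exists_padicLogOnUnits_not_logVolumeCompatible` at `ϖ = 3`, `c = −1`; the instance form the cone uses is
`logLinkVolumeCompatible_ofUnitLog` (THE `p`-adic logarithm, isometric `e`). [claim: Mochizuki2012, status: disputed] (IUTchIII §1 Prop 1.2 (iii), kurims p.31) -/
theorem not_forall_logLinkVolumeCompatible :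
    ¬ ∀ (K : Type) [NontriviallyNormedField K] [IsUltrametricDist K] [ProperSpace K] [MeasurableSpace K] [BorelSpace K]
        (K' : Type) [NontriviallyNormedField K'] [IsUltrametricDist K'] [ProperSpace K'] [MeasurableSpace K']
        [BorelSpace K'] (L : PadicLogOnUnits K) (e : K ≃+* K'), LogLinkVolumeCompatible L e := by
  intro h
  haveI : Fact (Nat.Prime 3) := ⟨Nat.prime_three⟩
  letI : MeasurableSpace ℚ_[3] := borel _
  haveI : BorelSpace ℚ_[3] := ⟨rfl⟩
  have h2 : ‖((-2 : ℤ) : ℚ_[3])‖ = 1 := by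
    refine le_antisymm (Padic.norm_int_le_one _) (not_lt.mp fun hlt => ?_)
    have : ((3 : ℕ) : ℤ) ∣ (-2 : ℤ) := Padic.norm_intCast_lt_one_iff.mp hlt
    omega
  have hc : ‖(-1 : ℚ_[3])‖ = 1 := by rw [norm_neg, norm_one]
  have hc1 : ‖((PadicUniformizer.varpi 3 : ℚ_[3]ˣ) : ℚ_[3])‖ < ‖(-1 : ℚ_[3]) - 1‖ := by
    have e1 : (-1 : ℚ_[3]) - 1 = ((-2 : ℤ) : ℚ_[3]) := by push_cast; ring
    rw [e1, h2]
    exact PadicUniformizer.norm_varpi_lt_one 3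
  obtain ⟨L, -, hL⟩ :=
    exists_padicLogOnUnits_not_logVolumeCompatible (K := ℚ_[3]) (PadicUniformizer.varpi 3)
      (PadicUniformizer.norm_varpi_lt_one 3) (-1) hc hc1
  exact hL (h ℚ_[3] ℚ_[3] L (RingEquiv.refl _)).1

end PadicLog

end Literature.IUT.LogThetaLattice

end
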